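import Summits.Parity.GeneralizedHardyLittlewood.Theorems.LeeYangFibresAbsoluteUpgradePencilChainZeroAux
import Summits.Parity.GeneralizedHardyLittlewood.Theorems.LeeYangFibresAbsoluteUpgradeDipDefs
import Literature.NumberTheory.LFunctions.UniversalityZeros
import HarnessLib

/-!
# Route `LeeYangFibres`, crux `AbsoluteUpgrade` (stmt-Parity-14116), line `dip-margin-rate-exchange`:
# the stub `pencil_chainZero` — a non-real zero of the model pencil with a clearance circle

Proof of the registered stub `pencil_chainZero : PencilChainZero` (pure complex analysis about `Γ`).
With `R(z) = Γ(1−z)/Γ(1+z)` and the compactness constant `C` of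
`pencilChainZero_compactBounds` on the rectangle `Y = [−A−1, 3] × [1/2, 3/2]`:

1. APPROXIMATE ZERO (`pencilChainZero_approx`).  For `x = log|τ|/(2Λ)`, `z₁ = x + i`,
   `q = τ/R(z₁)` put `L = Log q + 2πin` with `n = round((2Λ − arg q)/(2π))` and `ζ₀ = L/(2Λ)`; then
   `e^{2Λζ₀} = q`, `|Re ζ₀ − x| ≤ log C/(2Λ)`, `|Im ζ₀ − 1| ≤ π/(2Λ)`, so `|ζ₀ − z₁| ≤ (log C + 4)/(2Λ)`.
2. EXACT ZERO by the tree's maximum-modulus Rouché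
   (`Literature.NumberTheory.LFunctions.exists_zero_of_norm_sub_lt`) on the disc of radius
   `r = 1/(4Λ)` about `ζ₀`, comparing `g(w) = e^{2Λ(w−ζ₀)} R(w)/R(z₁) − 1` with
   `f(w) = e^{2Λ(w−ζ₀)} − 1` (`|f| ≥ 1/2 − 1/4` on the circle, `|g − f| ≤ 3C²(r + ε) < 1/8` on the
   disc by the Lipschitz bound for `R`): the zero `ζ` of `g` solves `e^{2Λζ}R(ζ) = e^{2Λζ₀}R(z₁) = τ`.
3. CLEARANCE on `|z − ζ| = r` (`pencilChainZero_core`): `e^{2Λz}R(z) = τ e^{y}(1 + η)` with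
   `|y| = 1/2`, `|η| ≤ C² r ≤ 1/60`, so `|τ − e^{2Λz}R(z)| ≥ |τ|(1/4 − 3/60) = |τ|/5`; multiply by
   `|Γ(1+z)|`.
4. The closed disc lies in `Y`, where `C⁻¹ ≤ |Γ(1∓z)| ≤ C`.
All thresholds are met for `Λ ≥ Λ₀ = 16 C² (log C + 4)`.
-/

noncomputable section

namespace Summit.Parity.GeneralizedHardyLittlewood.Cruxes.AbsoluteUpgrade.DipMarginRateExchange

open Complex Set Metric
open scoped Real

/-- On the circle `|y| = 1/2`: `|e^y − 1| ≥ |y| − |e^y − 1 − y| ≥ 1/2 − 1/4`. -/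
theorem pencilChainZero_norm_exp_sub_one_ge {y : ℂ} (hy : ‖y‖ = 1 / 2) :
    1 / 4 ≤ ‖Complex.exp y - 1‖ := by
  have h1 : ‖Complex.exp y - 1 - y‖ ≤ ‖y‖ ^ 2 :=
    Complex.norm_exp_sub_one_sub_id_le (by rw [hy]; norm_num)
  have h2 : ‖y‖ ≤ ‖Complex.exp y - 1‖ + ‖Complex.exp y - 1 - y‖ :=
    calc ‖y‖ = ‖(Complex.exp y - 1) - (Complex.exp y - 1 - y)‖ := by rw [sub_sub_cancel]
      _ ≤ ‖Complex.exp y - 1‖ + ‖Complex.exp y - 1 - y‖ := norm_sub_le _ _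
  rw [hy] at h1 h2
  nlinarith [h1, h2]

/-- On the disc `|y| ≤ 1/2`: `|e^y| = e^{Re y} ≤ e ≤ 3`. -/
theorem pencilChainZero_norm_exp_le {y : ℂ} (hy : ‖y‖ ≤ 1 / 2) : ‖Complex.exp y‖ ≤ 3 := by
  rw [Complex.norm_exp]
  have h : y.re ≤ 1 := by linarith [Complex.abs_re_le_norm y, le_abs_self y.re]
  exact (Real.exp_le_exp.2 h).trans Real.exp_one_lt_three.le

/-- The clearance inequality: `|(1 − e^y) − e^y η| ≥ 1/4 − 3/60 = 1/5` for `|y| = 1/2`,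
`|η| ≤ 1/60`. -/
theorem pencilChainZero_core {y η : ℂ} (hy : ‖y‖ = 1 / 2) (hη : ‖η‖ ≤ 1 / 60) :
    1 / 5 ≤ ‖(1 - Complex.exp y) - Complex.exp y * η‖ := by
  have h1 : 1 / 4 ≤ ‖1 - Complex.exp y‖ := by
    rw [norm_sub_rev]; exact pencilChainZero_norm_exp_sub_one_ge hy
  have h2 : ‖Complex.exp y * η‖ ≤ 3 * (1 / 60) := by
    rw [norm_mul]
    exact mul_le_mul (pencilChainZero_norm_exp_le hy.le) hη (norm_nonneg _) (by norm_num)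
  have h3 := norm_sub_norm_le (1 - Complex.exp y) (Complex.exp y * η)
  linarith

/-- Algebra of the Rouché comparison: `(E·R_w/R₁ − 1) − (E − 1) = E (R_w − R₁)/R₁`. -/
theorem pencilChainZero_id1 {E Rw R1 : ℂ} (h : R1 ≠ 0) :
    (E * Rw / R1 - 1) - (E - 1) = E * ((Rw - R1) * R1⁻¹) := by
  field_simp
  ring

/-- Algebra of the clearance: with `τ = E_ζ R_ζ`,
`τ G − E_y E_ζ (R_z G) = τ ((1 − E_y) − E_y (R_z − R_ζ)/R_ζ) G`. -/
theorem pencilChainZero_id2 {EZ Ey Rz RZ G : ℂ} (h : RZ ≠ 0) :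
    EZ * RZ * G - Ey * EZ * (Rz * G) = EZ * RZ * ((1 - Ey) - Ey * ((Rz - RZ) * RZ⁻¹)) * G := by
  field_simp
  ring

/-- Points within `1/2` of `x + i`, `−A ≤ x ≤ 1/2`, lie in the rectangle `[−A−1, 3] × [1/2, 3/2]`. -/
theorem pencilChainZero_mem_rect {A x : ℝ} (hxA : -A ≤ x) (hx : x ≤ 1 / 2) {w : ℂ}
    (hw : ‖w - (x + I)‖ ≤ 1 / 2) : w ∈ Set.Icc (-A - 1) 3 ×ℂ Set.Icc (1 / 2) (3 / 2) := by
  have hre := Complex.abs_re_le_norm (w - (x + I))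
  have him := Complex.abs_im_le_norm (w - (x + I))
  have e1 : (w - (x + I)).re = w.re - x := by simp
  have e2 : (w - (x + I)).im = w.im - 1 := by simp
  rw [e1] at hre
  rw [e2] at him
  rw [abs_le] at hre him
  refine mem_reProdIm.2 ⟨⟨?_, ?_⟩, ?_, ?_⟩ <;> linarith [hre.1, hre.2, him.1, him.2]

/-- **The approximate zero.** For `Λ > 0` and `q ≠ 0` there is `ζ₀` with `e^{2Λζ₀} = q`,
`Re ζ₀ = log|q|/(2Λ)` and `|Im ζ₀ − 1| ≤ π/(2Λ)`: `ζ₀ = (Log q + 2πin)/(2Λ)` with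
`n = round((2Λ − arg q)/(2π))`. -/
theorem pencilChainZero_approx {Λ : ℝ} (hΛ : 0 < Λ) {q : ℂ} (hq : q ≠ 0) :
    ∃ ζ₀ : ℂ, Complex.exp (2 * (Λ : ℂ) * ζ₀) = q ∧ ζ₀.re = Real.log ‖q‖ / (2 * Λ) ∧
      |ζ₀.im - 1| ≤ π / (2 * Λ) := by
  set n : ℤ := round ((2 * Λ - arg q) / (2 * π)) with hn
  set L : ℂ := log q + n * (2 * π * I) with hL
  have hexpL : exp L = q := by
    rw [hL, Complex.exp_add, Complex.exp_log hq, Complex.exp_int_mul_two_pi_mul_I, mul_one]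
  have hLre : L.re = Real.log ‖q‖ := by simp [hL, Complex.log_re]
  have hLim : L.im = arg q + n * (2 * π) := by simp [hL, Complex.log_im]
  have h2Λ : ((2 * Λ : ℝ) : ℂ) ≠ 0 := ofReal_ne_zero.2 (by positivity)
  refine ⟨L / ((2 * Λ : ℝ) : ℂ), ?_, ?_, ?_⟩
  · rw [show (2 : ℂ) * (Λ : ℂ) = ((2 * Λ : ℝ) : ℂ) by push_cast; ring, mul_div_cancel₀ _ h2Λ, hexpL]
  · rw [div_ofReal_re, hLre]
  · rw [div_ofReal_im, hLim]
    have h1 : (arg q + n * (2 * π)) / (2 * Λ) - 1 =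
        -(2 * π * ((2 * Λ - arg q) / (2 * π) - n)) / (2 * Λ) := by
      field_simp
      ring
    have h2 := abs_sub_round ((2 * Λ - arg q) / (2 * π))
    rw [← hn] at h2
    rw [h1, abs_div, abs_neg, abs_mul, abs_of_pos (by positivity : (0 : ℝ) < 2 * π),
      abs_of_pos (by positivity : (0 : ℝ) < 2 * Λ)]
    exact div_le_div_of_nonneg_right (by nlinarith [h2, Real.pi_pos]) (by positivity)

/-- **The stub `pencil_chainZero`** (line `dip-margin-rate-exchange`, crux `AbsoluteUpgrade`): an exact
non-real zero `ζ` of `e^{2Λζ}Γ(1−ζ) − τΓ(1+ζ)` near `log|τ|/(2Λ) + i`, with the clearance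
`|τΓ(1+z) − e^{2Λz}Γ(1−z)| ≥ (|τ|/5)|Γ(1+z)|` on `|z − ζ| = 1/(4Λ)` and two-sided bounds for `Γ(1∓z)` on
the closed disc.  See the module docstring for the proof. -/
theorem pencil_chainZero : PencilChainZero := by
  intro A hA
  obtain ⟨C, hC1, hK⟩ := pencilChainZero_compactBounds A
  have hCpos : 0 < C := by linarith
  have hlogC : 0 ≤ Real.log C := Real.log_nonneg hC1
  set B : ℝ := Real.log C + 4 with hB
  have hB4 : 4 ≤ B := by simp only [hB]; linarith
  refine ⟨C, hCpos, 16 * C ^ 2 * B, by positivity, ?_⟩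
  intro Λ hΛ τ hτ hτ2 hxA
  -- numerics
  have hC2 : 1 ≤ C ^ 2 := by nlinarith
  have hCB : 4 * C ^ 2 ≤ C ^ 2 * B := by nlinarith
  have hΛC : 16 * C ^ 2 ≤ Λ := by nlinarith
  have hΛB : 16 * B ≤ Λ := by nlinarith
  have hΛ64 : 64 ≤ Λ := by nlinarith
  have hΛpos : 0 < Λ := by linarith
  set x : ℝ := Real.log |τ| / (2 * Λ) with hx
  set r : ℝ := 1 / (4 * Λ) with hr
  set ε : ℝ := B / (2 * Λ) with hε
  have hrpos : 0 < r := by positivity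
  have hεpos : 0 < ε := by positivity
  have h2Λr : 2 * Λ * r = 1 / 2 := by simp only [hr]; field_simp; ring
  have hgeom : 2 * r + ε < 1 / 4 := by
    have h : 2 * r + ε = (1 + B) / (2 * Λ) := by simp only [hr, hε]; field_simp; ring
    rw [h, div_lt_iff₀ (by positivity)]; nlinarith
  have hclose_num : 3 * C ^ 2 * (r + ε) < 1 / 8 := by
    have h : 3 * C ^ 2 * (r + ε) = 3 * C ^ 2 * (1 + 2 * B) / (4 * Λ) := by
      simp only [hr, hε]; field_simp; ring
    rw [h, div_lt_iff₀ (by positivity)]; nlinarith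
  have hclear_num : C * r * C ≤ 1 / 60 := by
    have h : C * r * C = C ^ 2 / (4 * Λ) := by simp only [hr]; field_simp
    rw [h, div_le_iff₀ (by positivity)]; nlinarith
  have hnorm2Λ : ∀ w : ℂ, ‖2 * (Λ : ℂ) * w‖ = 2 * Λ * ‖w‖ := fun w => by
    rw [norm_mul, norm_mul, Complex.norm_two, Complex.norm_real, Real.norm_eq_abs, abs_of_pos hΛpos]
  -- facts about `τ` and `x`
  have hτpos : 0 < |τ| := abs_pos.2 hτ
  have hτC : (τ : ℂ) ≠ 0 := ofReal_ne_zero.2 hτ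
  have hnormτ : ‖(τ : ℂ)‖ = |τ| := by rw [Complex.norm_real, Real.norm_eq_abs]
  have hx1 : x ≤ 1 / 2 := by
    have h1 : Real.log |τ| ≤ 1 := by
      have := Real.log_le_log hτpos hτ2
      linarith [Real.log_two_lt_d9]
    simp only [hx]; rw [div_le_iff₀ (by positivity)]; nlinarith
  -- the rectangle and the ratio `R`
  set K : Set ℂ := Set.Icc (-A - 1) 3 ×ℂ Set.Icc (1 / 2) (3 / 2) with hKdef
  set z₁ : ℂ := (x : ℂ) + I with hz₁
  have hmem : ∀ w : ℂ, ‖w - z₁‖ ≤ 1 / 2 → w ∈ K := fun w hw => pencilChainZero_mem_rect hxA hx1 hw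
  have hKU : ∀ w ∈ K, 0 < w.im := fun w hw => by
    have h := (mem_reProdIm.1 hw).2.1; linarith
  set R : ℂ → ℂ := fun z => Gamma (1 - z) / Gamma (1 + z) with hRdef
  have hRlip : ∀ z ∈ K, ∀ w ∈ K, ‖R w - R z‖ ≤ C * ‖w - z‖ := fun z hz w hw => (hK z hz).2.2.2 w hw
  have hRlo : ∀ z ∈ K, C⁻¹ ≤ ‖R z‖ := fun z hz => (hK z hz).2.1
  have hRhi : ∀ z ∈ K, ‖R z‖ ≤ C := fun z hz => (hK z hz).2.2.1
  have hRpos : ∀ z ∈ K, 0 < ‖R z‖ := fun z hz => lt_of_lt_of_le (inv_pos.2 hCpos) (hRlo z hz)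
  have hR0 : ∀ z ∈ K, R z ≠ 0 := fun z hz => norm_pos_iff.1 (hRpos z hz)
  have hRinv : ∀ z ∈ K, ‖(R z)⁻¹‖ ≤ C := fun z hz => by
    rw [norm_inv]; exact inv_le_of_inv_le₀ hCpos (hRlo z hz)
  have hGp0 : ∀ z ∈ K, Gamma (1 + z) ≠ 0 := fun z hz =>
    (pencilChainZero_Gamma_ne_zero (hKU z hz)).1
  have hRd : DifferentiableOn ℂ R {z : ℂ | 0 < z.im} := pencilChainZero_differentiableOn.2.2
  have hz₁K : z₁ ∈ K := hmem z₁ (by simp)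
  have hRz₁ : R z₁ ≠ 0 := hR0 z₁ hz₁K
  -- Step 1: the approximate zero `ζ₀`
  set q : ℂ := (τ : ℂ) / R z₁ with hq
  have hq0 : q ≠ 0 := div_ne_zero hτC hRz₁
  obtain ⟨ζ₀, hexpζ₀, hζ₀re, hζ₀im1⟩ := pencilChainZero_approx hΛpos hq0
  have hζ₀rex : |ζ₀.re - x| ≤ Real.log C / (2 * Λ) := by
    have h1 : ζ₀.re - x = -Real.log ‖R z₁‖ / (2 * Λ) := by
      rw [hζ₀re, hx, hq, norm_div, hnormτ, Real.log_div hτpos.ne' (hRpos z₁ hz₁K).ne']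
      ring
    have h2 : |Real.log ‖R z₁‖| ≤ Real.log C := by
      rw [abs_le]
      constructor
      · rw [← Real.log_inv]
        exact Real.log_le_log (inv_pos.2 hCpos) (hRlo z₁ hz₁K)
      · exact Real.log_le_log (hRpos z₁ hz₁K) (hRhi z₁ hz₁K)
    rw [h1, abs_div, abs_neg, abs_of_pos (by positivity : (0 : ℝ) < 2 * Λ)]
    exact div_le_div_of_nonneg_right h2 (by positivity)
  have hζ₀z₁ : ‖ζ₀ - z₁‖ ≤ ε := by
    have h1 := Complex.norm_le_abs_re_add_abs_im (ζ₀ - z₁)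
    have hre : (ζ₀ - z₁).re = ζ₀.re - x := by simp [hz₁]
    have him : (ζ₀ - z₁).im = ζ₀.im - 1 := by simp [hz₁]
    rw [hre, him] at h1
    have h3 : Real.log C / (2 * Λ) + π / (2 * Λ) ≤ ε := by
      rw [hε, ← add_div]
      exact div_le_div_of_nonneg_right (by linarith [Real.pi_le_four]) (by positivity)
    linarith [hζ₀im1, hζ₀rex]
  have hballK : ∀ w : ℂ, ‖w - ζ₀‖ ≤ r → w ∈ K ∧ ‖w - z₁‖ ≤ r + ε := fun w hw => by
    have h1 : ‖w - z₁‖ ≤ r + ε :=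
      calc ‖w - z₁‖ = ‖(w - ζ₀) + (ζ₀ - z₁)‖ := by rw [sub_add_sub_cancel]
        _ ≤ ‖w - ζ₀‖ + ‖ζ₀ - z₁‖ := norm_add_le _ _
        _ ≤ r + ε := add_le_add hw hζ₀z₁
    exact ⟨hmem w (by linarith), h1⟩
  -- Step 2: the exact zero by Rouché (maximum-modulus form)
  have hgd : DiffContOnCl ℂ (fun w => exp (2 * (Λ : ℂ) * (w - ζ₀)) * R w / R z₁ - 1) (ball ζ₀ r) := by
    have he : Differentiable ℂ fun w : ℂ => exp (2 * (Λ : ℂ) * (w - ζ₀)) := by fun_prop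
    refine (((he.differentiableOn.fun_mul hRd).div_const (R z₁)).sub_const 1).diffContOnCl_ball ?_
    intro w hw
    rw [mem_closedBall, dist_eq_norm] at hw
    exact hKU w (hballK w hw).1
  have hδ : ∀ w ∈ sphere ζ₀ r, 1 / 4 ≤ ‖exp (2 * (Λ : ℂ) * (w - ζ₀)) - 1‖ := by
    intro w hw
    rw [mem_sphere, dist_eq_norm] at hw
    apply pencilChainZero_norm_exp_sub_one_ge
    rw [hnorm2Λ, hw, h2Λr]
  have hclose : ∀ w ∈ closedBall ζ₀ r,
      ‖(exp (2 * (Λ : ℂ) * (w - ζ₀)) * R w / R z₁ - 1) - (exp (2 * (Λ : ℂ) * (w - ζ₀)) - 1)‖ <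
        1 / 4 / 2 := by
    intro w hw
    rw [mem_closedBall, dist_eq_norm] at hw
    obtain ⟨hwK, hwz₁⟩ := hballK w hw
    rw [pencilChainZero_id1 hRz₁, norm_mul, norm_mul]
    have he3 : ‖exp (2 * (Λ : ℂ) * (w - ζ₀))‖ ≤ 3 := pencilChainZero_norm_exp_le (by
      rw [hnorm2Λ]; nlinarith [mul_le_mul_of_nonneg_left hw (by positivity : (0 : ℝ) ≤ 2 * Λ)])
    have hRw : ‖R w - R z₁‖ ≤ C * (r + ε) :=
      (hRlip z₁ hz₁K w hwK).trans (mul_le_mul_of_nonneg_left hwz₁ hCpos.le)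
    have hRi : ‖(R z₁)⁻¹‖ ≤ C := hRinv z₁ hz₁K
    calc ‖exp (2 * (Λ : ℂ) * (w - ζ₀))‖ * (‖R w - R z₁‖ * ‖(R z₁)⁻¹‖) ≤ 3 * (C * (r + ε) * C) :=
          mul_le_mul he3 (mul_le_mul hRw hRi (norm_nonneg _) (by positivity)) (by positivity)
            (by norm_num)
      _ = 3 * C ^ 2 * (r + ε) := by ring
      _ < 1 / 8 := hclose_num
      _ = 1 / 4 / 2 := by norm_num
  obtain ⟨ζ, hζball, hgζ⟩ := Literature.NumberTheory.LFunctions.exists_zero_of_norm_sub_lt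
    (f := fun w => exp (2 * (Λ : ℂ) * (w - ζ₀)) - 1)
    (g := fun w => exp (2 * (Λ : ℂ) * (w - ζ₀)) * R w / R z₁ - 1)
    hrpos hgd (by simp) hδ hclose
  rw [mem_ball, dist_eq_norm] at hζball
  have hζK : ζ ∈ K ∧ ‖ζ - z₁‖ ≤ r + ε := hballK ζ hζball.le
  have hgζ' : exp (2 * (Λ : ℂ) * (ζ - ζ₀)) * R ζ = R z₁ := by
    have h : exp (2 * (Λ : ℂ) * (ζ - ζ₀)) * R ζ / R z₁ - 1 = 0 := hgζ
    rw [sub_eq_zero, div_eq_iff hRz₁, one_mul] at h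
    exact h
  have hmain : exp (2 * (Λ : ℂ) * ζ) * R ζ = τ := by
    have h1 : 2 * (Λ : ℂ) * ζ = 2 * Λ * ζ₀ + 2 * Λ * (ζ - ζ₀) := by ring
    rw [h1, Complex.exp_add, hexpζ₀, mul_assoc, hgζ', hq, div_mul_cancel₀ _ hRz₁]
  have hRζ0 : R ζ ≠ 0 := hR0 ζ hζK.1
  have hζz₁re : |ζ.re - x| ≤ ‖ζ - z₁‖ := by
    have h := Complex.abs_re_le_norm (ζ - z₁)
    have hre : (ζ - z₁).re = ζ.re - x := by simp [hz₁]
    rw [hre] at h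
    exact h
  have hζz₁im : |ζ.im - 1| ≤ ‖ζ - z₁‖ := by
    have h := Complex.abs_im_le_norm (ζ - z₁)
    have him : (ζ - z₁).im = ζ.im - 1 := by simp [hz₁]
    rw [him] at h
    exact h
  rw [abs_le] at hζz₁im
  refine ⟨ζ, ?_, ?_, ?_, ?_, ?_, ?_⟩
  · linarith [hζz₁im.1, hζK.2]
  · linarith [hζz₁im.2, hζK.2]
  · linarith [hζK.2]
  · -- the equation
    have hGmζ : Gamma (1 - ζ) = R ζ * Gamma (1 + ζ) := by
      simp only [hRdef]; rw [div_mul_cancel₀ _ (hGp0 ζ hζK.1)]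
    rw [hGmζ, ← mul_assoc, hmain]
  · -- the clearance circle
    intro z hz
    have hzK : z ∈ K := hmem z (by
      calc ‖z - z₁‖ = ‖(z - ζ) + (ζ - z₁)‖ := by rw [sub_add_sub_cancel]
        _ ≤ ‖z - ζ‖ + ‖ζ - z₁‖ := norm_add_le _ _
        _ ≤ 1 / 2 := by linarith [hζK.2])
    have hynorm : ‖2 * (Λ : ℂ) * (z - ζ)‖ = 1 / 2 := by rw [hnorm2Λ, hz, h2Λr]
    have hexpz : exp (2 * (Λ : ℂ) * z) = exp (2 * (Λ : ℂ) * (z - ζ)) * exp (2 * (Λ : ℂ) * ζ) := by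
      rw [← Complex.exp_add]; congr 1; ring
    have hGm : Gamma (1 - z) = R z * Gamma (1 + z) := by
      simp only [hRdef]; rw [div_mul_cancel₀ _ (hGp0 z hzK)]
    have hη : ‖(R z - R ζ) * (R ζ)⁻¹‖ ≤ 1 / 60 := by
      rw [norm_mul]
      have hRz : ‖R z - R ζ‖ ≤ C * r := by
        have h := hRlip ζ hζK.1 z hzK
        rw [hz] at h
        exact h
      have hRi : ‖(R ζ)⁻¹‖ ≤ C := hRinv ζ hζK.1
      exact (mul_le_mul hRz hRi (norm_nonneg _) (by positivity)).trans hclear_num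
    have hX := pencilChainZero_core hynorm hη
    rw [hGm, hexpz, ← hmain, pencilChainZero_id2 hRζ0, norm_mul, norm_mul, hmain, hnormτ]
    calc |τ| / 5 * ‖Gamma (1 + z)‖ = |τ| * (1 / 5) * ‖Gamma (1 + z)‖ := by ring
      _ ≤ |τ| * ‖(1 - exp (2 * (Λ : ℂ) * (z - ζ))) -
            exp (2 * (Λ : ℂ) * (z - ζ)) * ((R z - R ζ) * (R ζ)⁻¹)‖ * ‖Gamma (1 + z)‖ :=
        mul_le_mul_of_nonneg_right (mul_le_mul_of_nonneg_left hX (abs_nonneg τ)) (norm_nonneg _)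
  · -- the closed disc lies in the rectangle
    intro z hz
    have hzK : z ∈ K := hmem z (by
      calc ‖z - z₁‖ = ‖(z - ζ) + (ζ - z₁)‖ := by rw [sub_add_sub_cancel]
        _ ≤ ‖z - ζ‖ + ‖ζ - z₁‖ := norm_add_le _ _
        _ ≤ 1 / 2 := by linarith [hζK.2])
    exact (hK z hzK).1

end Summit.Parity.GeneralizedHardyLittlewood.Cruxes.AbsoluteUpgrade.DipMarginRateExchange

end
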